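import Summits.QuantumFields.BalabanUV.T4Continuum.Support.NE9FutureProfileRecordPrelim

/-!
# NE9FutureProfileEndOfRecord — ROUTE R4's END OF RECORD: `NE9 ∧ FadingMemory` at the Earle–Hamilton rate `2θ∕(1+θ)` for a
# functional carrying the END of record's structural binders (base-free runs, `AdmissibleTerms`, `AdmRestrict`, `ChannelAdditive`,
# `ChannelLocal`, `ChannelSizeAtStepNN`, `Factorises`, `LastCouplingLipschitz`), given ONE complex slice map `ΦY k s : Pot → 𝔜`
# Fréchet-holomorphic and `B₀`-bounded on the table ball and REAL (= the record's new slice) at the record's tables, and the room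
# `ω̂·r + (√2·τ̄)·B₀ ≤ θ·r` — K2♭ (`NE9FutureProfileEnd`, leaf-04 g45) DOCKED at the record (INTERFACE REQUEST NE9 (R4-4), owner)

Cell `pub-balaban`, T4-DAG §6 NE9; BINDER row NE9 OWNER lineage `b2b-balaban-t4-ne9-p1` gen 60, CRUX PROVER NE9 (ruling e34b3e0c (2));
route R4 «fading by Earle–Hamilton» (`t4/ROUTES-NE9.md` v4 §L1.0 EH1–EH4).  Letters: `Pot := lp (ι → ℂ) ∞` (the END of record's table
space, `NE9TableReading`), `𝔜 := lp (Bg × C.Dom → ℂ) ∞` (the AMBIENT slice space of `NE9SliceSpaceOfRecord`; complete — no closedness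
of `Adm` is needed: leaf-03 g40 J-ne9leaf03g40-1, repair (B′)), readings `RdAmb` (`NE9ChannelReadingOfRecord` §6, Hahn–Banach extended),
`J k := injRead RdAmb …`, `coord := τ₀⁻¹ • coord κ U X`, `e₀ := 0`, `τ₀ := √2·τ̄` (cancels from the moduli).
HONEST FRAMING (T4-DAG PAGE 1).  Rung (B)+1 of the FINITE-VOLUME T⁴ programme — NOT infinite volume, NOT a mass gap, NOT Clay.  NE9
(`T4OutputRate.NE9` ∧ `FadingMemory`) is a cell NEW ESTIMATE, NOT PRINTED in [I] = [Balaban1987RG1] (CMP **109**), [II] =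
[Balaban1988RG2Cluster] (CMP **116**), NOT PROVED for Bałaban's E^{(j)}: the theorem below is «NE9 ⇐ the named binders» for an ABSTRACT
functional; the slice map's clauses (Φ-holo)∕(Φ-size)∕(Φ-real) are the INSTANCE's burden ((R-0)[scope] on the inflated box through (♮)
`GateauxHolomorphicBall`, (♭) `NE9EllInftyHolomorphy`, (δ) `SymmetryPrincipleBanach`) and W1 = model O-NE9-1 is untouched; spine 0∕9.
HONEST DEPENDENCY (cell line, verbatim): continuum YM on T⁴ ⇐ BetaPertH ∧ nine spine estimates (0/9 proved); BetaPertH ⇐ (D1) ∧ (D4) ∧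
CAP+tail; G-an2-4 gates asym, D1 and NE2/3/4.  `FlowStep.BetaPertH`, (B), (B^μ) do not occur; [I]∕[II] for TYPES only (ABSOLUTE RULE).
WHAT IS PROVED ([folklore] bookkeeping; the analysis is the imported kernel `NE9EarleHamiltonChain`): §1 table∕slice bookkeeping and
`norm_emb_le` (the orbit stays in the inner ball; generic); §2 the record's injection `JRec` (‖·‖ ≤ √2·τ̄) and **`orbit_of_record`** —
EH1 AT THE RECORD by induction on the step: (i) every slice of `E g` of creation step `≤ k` has decay-weighted size `≤ B₀`, (ii) the
slice coordinate IS `τ₀ • embR κ (E g)↾k`, (iii) the profile coordinate at `(n, s)` IS `ω̂⁻ⁿ •` the record's weighted reading of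
`T (k+n) s (truncScale k (E g))`; §3 **`ne9_and_fadingMemory_of_holoSlice`** — THE END: `NE9 E W κ (prodModuli ((2∕(1−θ))·ℓ) (fun _ =>
2θ∕(1+θ))) ∧ FadingMemory …` — no Lipschitz constant of the step, no `τ̄` in the rate, no `hocc`, no margin `R₀ − s₀`.  DISGUISE TEST: an
abstract functional with displayed binders; the slice map's three clauses are hypotheses; 0 sorry.  Summits-side NEW work (LEAN
PLACEMENT RULE); imports `NE9FutureProfileEnd`, `NE9ChannelReadingOfRecord`, `NE9TableReading`, `T4HistoryLipschitzOuter` BY NAME.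
References (TYPES only): [Balaban1987RG1] CMP **109** (0.23) p. 256, (2.13) p. 268, p. 263; [Balaban1988RG2Cluster] CMP **116** (1.33)∕(1.36)
p. 9, p. 8 l. 9–10; [EarleHamilton1970].
-/

noncomputable section

namespace Summit.QuantumFields.BalabanUV.T4Continuum.NE9FutureProfileEndOfRecord

open Metric Set
open scoped BigOperators ENNReal
open Literature.MathematicalPhysics.QuantumFieldTheory.Balaban1983to89
open Literature.MathematicalPhysics.QuantumFieldTheory.Balaban1983to89.T4OutputRate
open Literature.MathematicalPhysics.QuantumFieldTheory.Balaban1983to89.T4HistoryLipschitzRecursion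
open Literature.MathematicalPhysics.QuantumFieldTheory.Balaban1983to89.T4HistoryLipschitzOuter
open Summit.QuantumFields.BalabanUV.T4Continuum.NE9EarleHamiltonChain
open Summit.QuantumFields.BalabanUV.T4Continuum.NE9FutureProfileStep
open Summit.QuantumFields.BalabanUV.T4Continuum.NE9FutureProfileEnd
open Summit.QuantumFields.BalabanUV.T4Continuum.NE9ChannelRealLinear
open Summit.QuantumFields.BalabanUV.T4Continuum.NE9SliceSpaceOfRecord
open Summit.QuantumFields.BalabanUV.T4Continuum.NE9ChannelReadingOfRecord
open Summit.QuantumFields.BalabanUV.T4Continuum.NE9TableReading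
open Summit.QuantumFields.BalabanUV.T4Continuum.NE9FutureProfileRecordPrelim

variable {C : Carriers} {Bg ι : Type}

/-! ## §1 The orbit identification -/

section Record

variable [Nonempty ι] {E : Functional C Bg} {W : Set (ℕ → ℝ)} {Adm : Set (Bg → C.Dom → ℝ)}
  {T : ℕ → (ℕ → ℝ) → (Bg → C.Dom → ℝ) → ι → ℝ} {Ψ : ℕ → ℝ → (ι → ℝ) → Bg → C.Dom → ℝ}
  {κ : ℝ} {wt : ℕ → ι → ℝ} {τ : ℕ → ℕ → ℝ} {τbar ω ωh : ℝ}

/-- **THE ORBIT OF RECORD** (EH1 at the record, by induction on the step).  Hypotheses: the END of record's structural binders,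
base-free histories (`h0`, printed structure [I] (0.23) p. 256: no term before the first step), and the complex slice map `ΦY`
with (Φ-size) `‖ΦY k (g k) Q‖ ≤ B₀` on the table ball and (Φ-real) «at the record's tables `reading (wt k) (T k s (E g))` inside
the ball the weighted coordinates of `ΦY k (s k)` are REAL and equal the record's new slice `(Ψ k (s k) (T k s (E g)))↾(k+1)`»,
plus the room.  Then for every `g ∈ W` and `k`: (i) `|E g U X| ≤ e^{−κd(X)}·B₀` on creation steps `≤ k`; (ii) the slice
coordinate of the orbit IS `τ₀ • embR κ (E g)↾k`; (iii) the profile coordinate at `(n, s)` IS `ω̂⁻ⁿ •` the record's weighted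
reading of `T (k+n) s (truncScale k (E g))` (the orbit stays in the closed `θ·r`-ball by `norm_emb_le`). [folklore] -/
theorem orbit_of_record (h0 : ∀ g ∈ W, ∀ (U : Bg) (X : C.Dom), C.scale X = 0 → E g U X = 0)
    (hAdm : AdmissibleTerms E W Adm) (hres : AdmRestrict Adm) (hadd : ChannelAdditive Adm T) (hloc : ChannelLocal Adm T)
    (hstep : ChannelSizeAtStepNN Adm T κ wt τ) (hfac : Factorises E W T Ψ)
    (hsmul : ∀ (c : ℝ), ∀ H ∈ Adm, c • H ∈ Adm) (hne : Adm.Nonempty) (hwt : ∀ m y, 0 < wt m y)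
    (hτ : ∀ k j, j ≤ k → 0 ≤ τ k j ∧ τ k j ≤ τbar * ω ^ (k - j)) (hτbar : 0 ≤ τbar) (hω : 0 ≤ ω) (hωh : 0 < ωh)
    (hωωh : ω ≤ ωh) {ΦY : ℕ → ℝ → lp (fun _ : ι => ℂ) ∞ → lp (fun _ : Bg × C.Dom => ℂ) ∞} {r B₀ θ : ℝ} (hr : 0 < r)
    (hB₀ : 0 ≤ B₀) (hθ1 : θ < 1)
    (hΦb : ∀ k, ∀ g ∈ W, MapsTo (ΦY k (g k)) (ball (0 : lp (fun _ : ι => ℂ) ∞) r) (closedBall 0 B₀))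
    (hreal : ∀ k, ∀ g ∈ W, ∀ s ∈ W, reading (wt k) (T k s (E g)) ∈ ball (0 : lp (fun _ : ι => ℂ) ∞) r →
      ∀ (U : Bg) (X : C.Dom), (ΦY k (s k) (reading (wt k) (T k s (E g))) : Bg × C.Dom → ℂ) (U, X) =
        ((Real.exp (κ * C.d X) * restrictScale (k + 1) (Ψ k (s k) (T k s (E g))) U X : ℝ) : ℂ))
    (hroom : ωh * r + Real.sqrt 2 * τbar * B₀ ≤ θ * r) {g : ℕ → ℝ} (hg : g ∈ W) (k : ℕ) :
    (∀ (U : Bg) (X : C.Dom), C.scale X ≤ k → |E g U X| ≤ Real.exp (-(κ * C.d X)) * B₀) ∧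
      (emb W ΦY (JRec hadd hres hstep hAdm.2 hsmul hne hwt hτ hτbar hω hωh hωωh) (Real.sqrt 2 * τbar) ωh 0 k g).1 =
        ((Real.sqrt 2 * τbar : ℝ) : ℂ) • embR κ (restrictScale k (E g)) ∧
      (∀ (n : ℕ) (s : ℕ → ℝ) (hs : s ∈ W),
        (emb W ΦY (JRec hadd hres hstep hAdm.2 hsmul hne hwt hτ hτbar hω hωh hωωh) (Real.sqrt 2 * τbar) ωh 0 k g).2
            ⟨n, ⟨s, hs⟩⟩ =
          (((ωh⁻¹ : ℝ) : ℂ) ^ n) • reading (wt (k + n)) (T (k + n) s (truncScale k (E g)))) := by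
  set τ₀ : ℝ := Real.sqrt 2 * τbar with hτ₀def
  have hτ₀ : 0 ≤ τ₀ := mul_nonneg (Real.sqrt_nonneg _) hτbar
  set J := JRec hadd hres hstep hAdm.2 hsmul hne hwt hτ hτbar hω hωh hωωh with hJdef
  have hJ : ∀ k, ‖J k‖ ≤ τ₀ := fun k => norm_JRec_le k
  have hsum : ChannelStepSum Adm T := channelStepSum_of_local hres hadd hloc
  have hEg : E g ∈ Adm := hAdm.1 g hg
  have hθr : θ * r < r := by nlinarith
  have hd : ∀ k, ‖emb W ΦY J τ₀ ωh 0 k g‖ ≤ θ * r := fun k =>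
    norm_emb_le (fun k g hg => mapsTo_step hτ₀ hωh.le hΦb hJ hroom k hg) hθr
      (by rw [norm_zero]; nlinarith [mul_nonneg hτ₀ hB₀, mul_pos hωh hr]) k hg
  induction k with
  | zero =>
    have hz : truncScale 0 (E g) = 0 := truncScale_zero_eq_zero (h0 g hg)
    have hz' : restrictScale 0 (E g) = 0 := by
      funext U X
      by_cases hX : C.scale X = 0
      · rw [restrictScale_of_eq _ hX, h0 g hg U X hX, Pi.zero_apply, Pi.zero_apply]
      · rw [restrictScale_of_ne _ hX, Pi.zero_apply, Pi.zero_apply]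
    refine ⟨fun U X hX => ?_, ?_, fun n s hs => ?_⟩
    · rw [h0 g hg U X (Nat.le_zero.mp hX), abs_zero]; positivity
    · rw [emb_zero, Prod.fst_zero, hz', embR_zero, smul_zero]
    · have hT0 : T (0 + n) s 0 = 0 := funext fun y => channel_zero hadd hEg _ s y
      rw [emb_zero, Prod.snd_zero, BoundedContinuousFunction.coe_zero, Pi.zero_apply, hz, hT0,
        reading_zero_of_pos (hwt _), smul_zero]
  | succ k ih =>
    obtain ⟨ha, hb, hc⟩ := ih
    set e := emb W ΦY J τ₀ ωh 0 k g with hedef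
    -- F1: the profile coordinate at `(0, s)` is the record's table
    have hF1 : ∀ (s : ℕ → ℝ) (hs : s ∈ W), e.2 ⟨0, ⟨s, hs⟩⟩ = reading (wt k) (T k s (E g)) := by
      intro s hs
      have h1 := hc 0 s hs
      have hT : T (k + 0) s (truncScale k (E g)) = T k s (E g) := by
        funext y; rw [Nat.add_zero]; exact (hloc k s (E g) hEg y).symm
      rw [pow_zero, one_smul, hT] at h1
      simpa only [Nat.add_zero] using h1
    -- F2: those tables lie in the open `r`-ball
    have hF2 : ∀ (s : ℕ → ℝ) (hs : s ∈ W), reading (wt k) (T k s (E g)) ∈ ball (0 : lp (fun _ : ι => ℂ) ∞) r := by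
      intro s hs
      rw [← hF1 s hs, mem_ball_zero_iff]
      exact lt_of_le_of_lt ((e.2.norm_coe_le_norm _).trans ((norm_snd_le e).trans (hd k))) hθr
    -- the new slice of the record, and its identification
    set S : Bg → C.Dom → ℝ := restrictScale (k + 1) (E g) with hSdef
    have hSΨ : restrictScale (k + 1) (Ψ k (g k) (T k g (E g))) = S := by
      funext U X
      by_cases hX : C.scale X = k + 1
      · rw [hSdef, restrictScale_of_eq _ hX, restrictScale_of_eq _ hX, hfac g hg k U X hX]
      · rw [hSdef, restrictScale_of_ne _ hX, restrictScale_of_ne _ hX]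
    have hnew : newSlice W ΦY J τ₀ ωh 0 k g hg = ΦY k (g k) (reading (wt k) (T k g (E g))) := by
      rw [newSlice, ← hedef, hF1 g hg]
    have hcoordS := eq_embR_of_coord (κ := κ) (G := ΦY k (g k) (reading (wt k) (T k g (E g)))) (H := S)
      (fun U X => by rw [hreal k g hg g hg (hF2 g hg) U X, hSΨ])
    have hGB : ‖ΦY k (g k) (reading (wt k) (T k g (E g)))‖ ≤ B₀ := mem_closedBall_zero_iff.mp (hΦb k g hg (hF2 g hg))
    have hSb : ∀ (U : Bg) (X : C.Dom), |S U X| ≤ Real.exp (-(κ * C.d X)) * B₀ := fun U X =>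
      (hcoordS.1 U X).trans (mul_le_mul_of_nonneg_left hGB (Real.exp_pos _).le)
    have hSb' : ∀ (U : Bg) (X : C.Dom), C.scale X = k + 1 → |E g U X| ≤ Real.exp (-(κ * C.d X)) * B₀ := by
      intro U X hX
      have h := hSb U X
      rwa [hSdef, restrictScale_of_eq _ hX] at h
    -- (i)
    have ha' : ∀ (U : Bg) (X : C.Dom), C.scale X ≤ k + 1 → |E g U X| ≤ Real.exp (-(κ * C.d X)) * B₀ := by
      intro U X hX
      rcases Nat.lt_or_eq_of_le hX with hlt | heq
      · exact ha U X (Nat.lt_succ_iff.mp hlt)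
      · exact hSb' U X heq
    refine ⟨ha', ?_, fun n s hs => ?_⟩
    · -- (ii)
      rw [emb_succ_fst _ k hg, hnew, hcoordS.2]
    · -- (iii)
      have hm : k + (n + 1) = k + 1 + n := by omega
      have hTadd : T (k + 1 + n) s (truncScale (k + 1) (E g)) =
          T (k + 1 + n) s (truncScale k (E g)) + T (k + 1 + n) s S := by
        funext y
        rw [truncScale_succ_eq, Pi.add_apply]
        exact channel_add hadd hAdm.2 hsmul (hres.2 _ hEg k) (hres.1 _ hEg (k + 1)) _ s y
      have hb1 := abs_channel_trunc_le hres hsum hstep hEg hB₀ ha (k + 1 + n) s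
      have hb2 := abs_channel_restrict_le hres hsum hstep hEg hB₀ hSb' (k + 1 + n) s
      have hRd : RdAmb (κ := κ) hadd hres hstep hAdm.2 hsmul hne hwt (τ_nonneg hτ) (k + 1 + n) (k + 1) s (embR κ S) =
          reading (wt (k + 1 + n)) (T (k + 1 + n) s S) := by
        refine eq_reading_of_apply (hwt _) hb2 fun y => ?_
        rw [RdAmb_embR_apply (Nat.le_add_right _ _) s (hres.1 _ hEg (k + 1)) hSb y,
          NE9MarginalProjection.restrictScale_restrictScale_self]
      rw [emb_succ_snd_apply _ k hg, ← hedef, hc (n + 1) s hs, hnew, hcoordS.2]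
      show (ωh : ℂ) • _ + injRead _ _ _ _ _ _ k (embR κ S) ⟨n, ⟨s, hs⟩⟩ = _
      rw [injRead_apply, hRd, hm, hTadd, reading_add_of_bound (hwt _) hb1 hb2, smul_add, smul_smul]
      congr 1
      have hne : (ωh : ℂ) ≠ 0 := by exact_mod_cast hωh.ne'
      rw [Complex.ofReal_inv, pow_succ, mul_comm (ωh : ℂ), mul_assoc, inv_mul_cancel₀ hne, mul_one]

/-! ## §2 THE END OF ROUTE R4 AT THE RECORD -/

/-- **ROUTE R4's END OF RECORD — `NE9 ∧ FadingMemory` AT THE EARLE–HAMILTON RATE.**  For a functional `E` with: base-free histories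
(`h0`), the END of record's structural binders `AdmissibleTerms`∕`AdmRestrict`∕`ChannelAdditive`∕`ChannelLocal`∕`ChannelSizeAtStepNN`
(geometric weights `τ k j ≤ τ̄ω^{k−j}`)∕`Factorises`∕`LastCouplingLipschitz` (moduli `lam k ≤ ℓ`), the admissible class closed under
real scalars, positive table weights, and ONE complex slice map `ΦY k s : lp (ι → ℂ) ∞ → lp (Bg × C.Dom → ℂ) ∞` that is
(Φ-holo) Fréchet-holomorphic and (Φ-size) `B₀`-bounded on the table ball `‖Q‖ < r` at every occurring last coupling, and (Φ-real)
REAL = the record's new slice at the record's tables, with the ROOM `ω̂·r + (√2·τ̄)·B₀ ≤ θ·r`, `0 < θ < 1`, `ω ≤ ω̂`: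
`NE9 E W κ (prodModuli ((2∕(1−θ))·ℓ) (fun _ => 2θ∕(1+θ))) ∧ FadingMemory ((2∕(1−θ))·ℓ ∕ (2θ∕(1+θ))) (2θ∕(1+θ)) (…)`.  Proof:
K2♭ `NE9FutureProfileEnd.ne9_and_fadingMemory_futureInfluence_EH` on `𝔜 := lp (Bg × C.Dom → ℂ) ∞`, `J := injRead RdAmb`,
`e₀ := 0`, `coord := τ₀⁻¹ • coord κ U X` (`τ₀ = √2·τ̄` cancels), with `hΦlast` from `LastCouplingLipschitz` through (Φ-real) and
`embR`, and `hE` from the orbit identification §2.  «NE9 ⇐ the named binders»: the three (Φ-·) clauses are the INSTANCE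
((R-0)[scope] + (♮)(♭)(δ)); W1 = model O-NE9-1 untouched. [cite: Balaban1987RG1, (2.13) p.268; Balaban1988RG2Cluster, (1.36) p.9] -/
theorem ne9_and_fadingMemory_of_holoSlice (h0 : ∀ g ∈ W, ∀ (U : Bg) (X : C.Dom), C.scale X = 0 → E g U X = 0)
    (hAdm : AdmissibleTerms E W Adm) (hres : AdmRestrict Adm) (hadd : ChannelAdditive Adm T) (hloc : ChannelLocal Adm T)
    (hstep : ChannelSizeAtStepNN Adm T κ wt τ) (hfac : Factorises E W T Ψ) {lam : ℕ → ℝ}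
    (hlast : LastCouplingLipschitz E W T Ψ κ lam)
    (hsmul : ∀ (c : ℝ), ∀ H ∈ Adm, c • H ∈ Adm) (hne : Adm.Nonempty) (hwt : ∀ m y, 0 < wt m y)
    (hτ : ∀ k j, j ≤ k → 0 ≤ τ k j ∧ τ k j ≤ τbar * ω ^ (k - j)) (hτbar : 0 < τbar) (hω : 0 ≤ ω) (hωh : 0 < ωh)
    (hωωh : ω ≤ ωh) {ΦY : ℕ → ℝ → lp (fun _ : ι => ℂ) ∞ → lp (fun _ : Bg × C.Dom => ℂ) ∞} {r B₀ θ ℓ : ℝ} (hr : 0 < r)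
    (hB₀ : 0 ≤ B₀) (hθ0 : 0 < θ) (hθ1 : θ < 1) (hℓ : 0 ≤ ℓ)
    (hΦd : ∀ k, ∀ g ∈ W, DifferentiableOn ℂ (ΦY k (g k)) (ball (0 : lp (fun _ : ι => ℂ) ∞) r))
    (hΦb : ∀ k, ∀ g ∈ W, MapsTo (ΦY k (g k)) (ball (0 : lp (fun _ : ι => ℂ) ∞) r) (closedBall 0 B₀))
    (hreal : ∀ k, ∀ g ∈ W, ∀ s ∈ W, reading (wt k) (T k s (E g)) ∈ ball (0 : lp (fun _ : ι => ℂ) ∞) r →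
      ∀ (U : Bg) (X : C.Dom), (ΦY k (s k) (reading (wt k) (T k s (E g))) : Bg × C.Dom → ℂ) (U, X) =
        ((Real.exp (κ * C.d X) * restrictScale (k + 1) (Ψ k (s k) (T k s (E g))) U X : ℝ) : ℂ))
    (hroom : ωh * r + Real.sqrt 2 * τbar * B₀ ≤ θ * r) (hlam : ∀ k, lam k ≤ ℓ) :
    NE9 E W κ (prodModuli (2 / (1 - θ) * ℓ) fun _ => 2 * θ / (1 + θ)) ∧
      FadingMemory (2 / (1 - θ) * ℓ / (2 * θ / (1 + θ))) (2 * θ / (1 + θ))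
        (prodModuli (2 / (1 - θ) * ℓ) fun _ => 2 * θ / (1 + θ)) := by
  set τ₀ : ℝ := Real.sqrt 2 * τbar with hτ₀def
  have hτ₀pos : 0 < τ₀ := mul_pos (Real.sqrt_pos.mpr (by norm_num)) hτbar
  have hτ₀ : 0 ≤ τ₀ := hτ₀pos.le
  have hτ₀ne : (τ₀ : ℂ) ≠ 0 := by exact_mod_cast hτ₀pos.ne'
  set J := JRec (W := W) hadd hres hstep hAdm.2 hsmul hne hwt hτ hτbar.le hω hωh hωωh with hJdef
  have hJ : ∀ k, ‖J k‖ ≤ τ₀ := fun k => norm_JRec_le (W := W) k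
  have hθr : θ * r < r := by nlinarith
  -- the orbit identification, per history
  have horb := fun (g : ℕ → ℝ) (hg : g ∈ W) (k : ℕ) =>
    orbit_of_record h0 hAdm hres hadd hloc hstep hfac hsmul hne hwt hτ hτbar.le hω hωh hωωh hr hB₀ hθ1 hΦb hreal hroom hg k
  -- the profile coordinate at `(0, s)` is the record's table, inside the ball
  have hF1 : ∀ g (hg : g ∈ W) (k : ℕ) (s : ℕ → ℝ) (hs : s ∈ W),
      (emb W ΦY J τ₀ ωh 0 k g).2 ⟨0, ⟨s, hs⟩⟩ = reading (wt k) (T k s (E g)) := by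
    intro g hg k s hs
    have h1 := (horb g hg k).2.2 0 s hs
    have hT : T (k + 0) s (truncScale k (E g)) = T k s (E g) := by
      funext y; rw [Nat.add_zero]; exact (hloc k s (E g) (hAdm.1 g hg) y).symm
    rw [pow_zero, one_smul, hT] at h1
    simpa only [Nat.add_zero] using h1
  have hF2 : ∀ g (hg : g ∈ W) (k : ℕ) (s : ℕ → ℝ) (hs : s ∈ W),
      reading (wt k) (T k s (E g)) ∈ ball (0 : lp (fun _ : ι => ℂ) ∞) r := by
    intro g hg k s hs
    rw [← hF1 g hg k s hs, mem_ball_zero_iff]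
    exact lt_of_le_of_lt (((emb W ΦY J τ₀ ωh 0 k g).2.norm_coe_le_norm _).trans
      ((norm_snd_le _).trans (norm_emb_le (fun k g hg => mapsTo_step hτ₀ hωh.le hΦb hJ hroom k hg) hθr
        (by rw [norm_zero]; nlinarith [mul_nonneg hτ₀ hB₀, mul_pos hωh hr]) k hg))) hθr
  -- the slice map at the record's tables is the embedded real slice
  have hemb : ∀ g (hg : g ∈ W) (k : ℕ) (s : ℕ → ℝ) (hs : s ∈ W),
      (∀ (U : Bg) (X : C.Dom), |restrictScale (k + 1) (Ψ k (s k) (T k s (E g))) U X| ≤ Real.exp (-(κ * C.d X)) * B₀) ∧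
      ΦY k (s k) (reading (wt k) (T k s (E g))) = embR κ (restrictScale (k + 1) (Ψ k (s k) (T k s (E g)))) := by
    intro g hg k s hs
    have h := eq_embR_of_coord (κ := κ) (hreal k g hg s hs (hF2 g hg k s hs))
    have hGB : ‖ΦY k (s k) (reading (wt k) (T k s (E g)))‖ ≤ B₀ :=
      mem_closedBall_zero_iff.mp (hΦb k s hs (hF2 g hg k s hs))
    exact ⟨fun U X => (h.1 U X).trans (mul_le_mul_of_nonneg_left hGB (Real.exp_pos _).le), h.2⟩
  -- K2♭'s END
  have key := ne9_and_fadingMemory_futureInfluence_EH (W := W) (Φ := ΦY) (J := J) (τ₀ := τ₀) (ωh := ωh) E 0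
    (fun U X => ((τ₀⁻¹ : ℝ) : ℂ) • coord κ U X) (κ := κ) (cY := τ₀⁻¹) (lam := fun k => max (lam k) 0) hr hθ0 hθ1 hℓ
    (inv_nonneg.mpr hτ₀) hτ₀ hωh.le hΦd hΦb hJ hroom (by rw [norm_zero]; nlinarith) ?_ (fun k => max_le (hlam k) hℓ) ?_ ?_
  · have hc : τ₀⁻¹ * (2 / (1 - θ)) * (τ₀ * ℓ) = 2 / (1 - θ) * ℓ := by field_simp
    rwa [hc] at key
  · -- hΦlast from `LastCouplingLipschitz`
    intro k g hg g' hg'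
    rw [hF1 g hg k g hg, hF1 g hg k g' hg', (hemb g hg k g hg).2, (hemb g hg k g' hg').2,
      ← embR_sub (hemb g hg k g hg).1 (hemb g hg k g' hg').1]
    refine norm_embR_le (mul_nonneg (le_max_right _ _) (abs_nonneg _)) fun U X => ?_
    rw [Pi.sub_apply, Pi.sub_apply]
    by_cases hX : C.scale X = k + 1
    · rw [restrictScale_of_eq _ hX, restrictScale_of_eq _ hX]
      exact (hlast g hg g' hg' k U X hX).trans (mul_le_mul_of_nonneg_left
        (mul_le_mul_of_nonneg_right (le_max_left _ _) (abs_nonneg _)) (Real.exp_pos _).le)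
    · rw [restrictScale_of_ne _ hX, restrictScale_of_ne _ hX, sub_zero, abs_zero]; positivity
  · -- hcoord
    intro U X
    rw [norm_smul, Complex.norm_real, Real.norm_of_nonneg (inv_nonneg.mpr hτ₀)]
    exact mul_le_mul_of_nonneg_left (norm_coord_le κ U X) (inv_nonneg.mpr hτ₀)
  · -- hE from the orbit identification
    intro g hg U X
    rcases Nat.eq_zero_or_eq_succ_pred (C.scale X) with hX | hX
    · rw [hX, emb_zero, Prod.fst_zero, map_zero, Complex.zero_re, h0 g hg U X hX]
    · set k := (C.scale X).pred with hk
      rw [hX, (horb g hg (k + 1)).2.1, _root_.smul_apply, map_smul, smul_smul, Complex.ofReal_inv,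
        inv_mul_cancel₀ hτ₀ne, one_smul,
        coord_embR_re (N := B₀) (fun U X => ?_), restrictScale_of_eq _ hX]
      by_cases h' : C.scale X = k + 1
      · rw [restrictScale_of_eq _ h']; exact (horb g hg (k + 1)).1 U X h'.le
      · rw [restrictScale_of_ne _ h', abs_zero]; positivity

end Record

end Summit.QuantumFields.BalabanUV.T4Continuum.NE9FutureProfileEndOfRecord

end
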